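import Summits.HubbardSuperconductivity.HubbardSuperconductivity.Theorems.WidthUniformThermodynamics.Negative.WidthUniformThermodynamicsFreeOpenShell
import Summits.HubbardSuperconductivity.HubbardSuperconductivity.Theorems.WidthHaldaneTubePlaneWaves
import Summits.HubbardSuperconductivity.HubbardSuperconductivity.Theorems.PerWidthThermodynamics.Negative.OpenShellCounting

/-!
# `PerWidthThermodynamics` (stmt-HubbardSuperconductivity-18510), negative side:
# `0 < U` is load-bearing — at zero coupling the compressibility floor `0 < ẽ″` fails at fixed width,
# cofinally in the length, at every doping

Fixed-width twin of `WidthUniformThermodynamics/Negative/ZeroCouplingCompressibility.lean` (which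
treats the square members `M = L` of 16312's family), made possible by the free floor of the
RECTANGULAR tube (`WidthHaldaneTubePlaneWaves.tubeEnergy_free_eq`, on top of the general free-fermion
sector floor `WidthHaldaneFreeFloor`). Sorry-free:

* `odd_card_filter_tubeBand_le` — shell parity of the free band `ε_{L,M}(a,b) = -2cos(2πa/L) - 2cos(2πb/M)`
  for even `L, M`: `#{ε ≤ μ}` is odd for `-4 ≤ μ < 4` (involution `k ↦ -k`; fixed points
  `{0, L/2} × {0, M/2}` with band values `-4, 0, 0, 4`);
* `tubePairCompressibility_zero_coupling_eq_zero_of_openShell` / `_of_even` — on an open shell, in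
  particular whenever the pair number `n = N_{L,M}(δ)/2` is even (`0 < n < LM`), `ẽ″_{L,M}(0, δ) = 0`;
* `exists_admissible_tubePairCompressibility_zero_coupling_eq_zero` — at width `4` this happens for
  infinitely many even `L` at every `δ ∈ (0, 3/10)` (`exists_ge_even_floor` of `OpenShellCounting`);
* **`perWidthThermodynamics_false_at_zero_coupling`** — the crux with `U := 0` is false.

Together with `PerWidthThermodynamicsFalseWithoutL1` (`L₁` load-bearing, `M ≤ L` decoration) this
calibrates 18510 along its side conditions: `0 < U` and `L₁` are used by any proof. Sources:
D. J. Scalapino, S. R. White, S. C. Zhang, PRB 47 (1993) 7995 §II (compressibility criterion);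
J. Bardeen, L. N. Cooper, J. R. Schrieffer, Phys. Rev. 108 (1957) 1175 §II. Folklore; no definitions,
no named facts. REUSED: `exists_three_fermiSets`, `neg_eq_self_iff_of_even`, `half_ne_zero`,
`two_mul_val_half` (square-torus file), `tubeEnergy_free_eq`, `exists_openShell_of_card_ne`,
`exists_ge_even_floor`.
-/

noncomputable section

namespace Summit.HubbardSuperconductivity.HubbardSuperconductivity.Theorems.PerWidthThermodynamics.Negative

set_option linter.dupNamespace false -- summit = problem name (single-conjunct summit), D-0017

open scoped BigOperators Classical Matrix ComplexConjugate
open Matrix Finset Literature.MathematicalPhysics.QuantumLattice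
open Summit.HubbardSuperconductivity.HubbardSuperconductivity.Theorems.WidthHaldane
open Summit.HubbardSuperconductivity.HubbardSuperconductivity.Theorems.WidthUniformThermodynamics.Negative

/-! ### Shell parity of the rectangular band `ε_{L,M}` for even `L, M` -/

section Shells

variable {L M : ℕ} [NeZero L] [NeZero M]

/-- `cos(2π(-a).val/L) = cos(2π a.val/L)` (the representative of `-a` is `L - a.val` or `0`). [folklore] -/
theorem cos_two_pi_mul_val_neg (a : ZMod L) :
    Real.cos (2 * Real.pi * ((-a).val : ℝ) / L) = Real.cos (2 * Real.pi * (a.val : ℝ) / L) := by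
  rw [ZMod.neg_val]
  split_ifs with h
  · rw [h, ZMod.val_zero]
  · have hlt : a.val ≤ L := (ZMod.val_lt a).le
    rw [Nat.cast_sub hlt]
    have hL : (L : ℝ) ≠ 0 := Nat.cast_ne_zero.2 (NeZero.ne L)
    have : 2 * Real.pi * ((L : ℝ) - a.val) / L = 2 * Real.pi - 2 * Real.pi * (a.val : ℝ) / L := by
      field_simp
    rw [this, Real.cos_two_pi_sub]

/-- The free band is even: `ε_{L,M}(-k) = ε_{L,M}(k)`. [folklore] -/
theorem tubeBand_neg (k : ZMod L × ZMod M) : tubeBand L M (-k) = tubeBand L M k := by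
  simp only [tubeBand, Prod.fst_neg, Prod.snd_neg, cos_two_pi_mul_val_neg]

omit [NeZero L] in
/-- `cos(2π·0/L) = 1`. [folklore] -/
theorem cos_two_pi_mul_val_zero : Real.cos (2 * Real.pi * ((0 : ZMod L).val : ℝ) / L) = 1 := by
  rw [ZMod.val_zero, Nat.cast_zero, mul_zero, zero_div, Real.cos_zero]

/-- For even `L`, the half-period momentum has `cos(2π (L/2)/L) = -1`. [folklore] -/
theorem cos_two_pi_mul_val_half (hL : Even L) :
    Real.cos (2 * Real.pi * ((((L / 2 : ℕ) : ZMod L)).val : ℝ) / L) = -1 := by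
  have h2 := two_mul_val_half hL
  have hL0 : (L : ℝ) ≠ 0 := Nat.cast_ne_zero.2 (NeZero.ne L)
  have hv : (((((L / 2 : ℕ) : ZMod L)).val : ℕ) : ℝ) = (L : ℝ) / 2 := by
    have : (2 : ℝ) * (((((L / 2 : ℕ) : ZMod L)).val : ℕ) : ℝ) = L := by exact_mod_cast h2
    linarith
  rw [hv]
  have : 2 * Real.pi * ((L : ℝ) / 2) / L = Real.pi := by field_simp
  rw [this, Real.cos_pi]

omit [NeZero L] [NeZero M] in
/-- `-4 ≤ ε_{L,M}`. [folklore] -/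
theorem neg_four_le_tubeBand (k : ZMod L × ZMod M) : -4 ≤ tubeBand L M k := by
  have h1 := Real.cos_le_one (2 * Real.pi * (k.1.val : ℝ) / L)
  have h2 := Real.cos_le_one (2 * Real.pi * (k.2.val : ℝ) / M)
  rw [tubeBand]; linarith

omit [NeZero L] [NeZero M] in
/-- `ε_{L,M} ≤ 4`. [folklore] -/
theorem tubeBand_le_four (k : ZMod L × ZMod M) : tubeBand L M k ≤ 4 := by
  have h1 := Real.neg_one_le_cos (2 * Real.pi * (k.1.val : ℝ) / L)
  have h2 := Real.neg_one_le_cos (2 * Real.pi * (k.2.val : ℝ) / M)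
  rw [tubeBand]; linarith

/-- Fixed points of `k ↦ -k` on `ℤ/L × ℤ/M`, `L, M` even: both coordinates in `{0, half period}`. [folklore] -/
theorem prod_neg_eq_self_iff (hL : Even L) (hM : Even M) (k : ZMod L × ZMod M) :
    -k = k ↔ (k.1 = 0 ∨ k.1 = ((L / 2 : ℕ) : ZMod L)) ∧ (k.2 = 0 ∨ k.2 = ((M / 2 : ℕ) : ZMod M)) := by
  rw [Prod.ext_iff, Prod.fst_neg, Prod.snd_neg, neg_eq_self_iff_of_even hL, neg_eq_self_iff_of_even hM]

/-- The four fixed points of the negation and their band values `-4, 0, 0, 4`. [folklore] -/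
theorem tubeBand_of_neg_eq_self (hL : Even L) (hM : Even M) {k : ZMod L × ZMod M} (hk : -k = k) :
    (k = (0, 0) ∧ tubeBand L M k = -4) ∨ (k = (0, ((M / 2 : ℕ) : ZMod M)) ∧ tubeBand L M k = 0) ∨
      (k = (((L / 2 : ℕ) : ZMod L), 0) ∧ tubeBand L M k = 0) ∨
        (k = (((L / 2 : ℕ) : ZMod L), ((M / 2 : ℕ) : ZMod M)) ∧ tubeBand L M k = 4) := by
  rw [prod_neg_eq_self_iff hL hM] at hk
  obtain ⟨a, b⟩ := k
  simp only at hk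
  obtain ⟨h0 | h0, h1 | h1⟩ := hk <;> subst h0 <;> subst h1
  · left; refine ⟨rfl, ?_⟩
    rw [tubeBand, cos_two_pi_mul_val_zero, cos_two_pi_mul_val_zero]; norm_num
  · right; left; refine ⟨rfl, ?_⟩
    rw [tubeBand, cos_two_pi_mul_val_zero, cos_two_pi_mul_val_half hM]; norm_num
  · right; right; left; refine ⟨rfl, ?_⟩
    rw [tubeBand, cos_two_pi_mul_val_half hL, cos_two_pi_mul_val_zero]; norm_num
  · right; right; right; refine ⟨rfl, ?_⟩
    rw [tubeBand, cos_two_pi_mul_val_half hL, cos_two_pi_mul_val_half hM]; norm_num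

/-- The fixed points of the negation below a level `-4 ≤ μ < 4`: `{(0,0)}` or `{(0,0), (0,M/2), (L/2,0)}` —
an ODD number either way. [folklore] -/
theorem filter_tubeBand_le_and_fixed_eq (hL : Even L) (hM : Even M) {μ : ℝ} (hμ : μ < 4) (hμ' : -4 ≤ μ) :
    (univ.filter fun k : ZMod L × ZMod M => tubeBand L M k ≤ μ ∧ -k = k) =
      if (0 : ℝ) ≤ μ then {(0, 0), (0, ((M / 2 : ℕ) : ZMod M)), (((L / 2 : ℕ) : ZMod L), 0)} else {(0, 0)} := by
  have hb0 : tubeBand L M ((0, 0) : ZMod L × ZMod M) = -4 := by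
    rw [tubeBand, cos_two_pi_mul_val_zero, cos_two_pi_mul_val_zero]; norm_num
  have hba : tubeBand L M ((0, ((M / 2 : ℕ) : ZMod M)) : ZMod L × ZMod M) = 0 := by
    rw [tubeBand, cos_two_pi_mul_val_zero, cos_two_pi_mul_val_half hM]; norm_num
  have hbb : tubeBand L M ((((L / 2 : ℕ) : ZMod L), 0) : ZMod L × ZMod M) = 0 := by
    rw [tubeBand, cos_two_pi_mul_val_half hL, cos_two_pi_mul_val_zero]; norm_num
  have hfix : ∀ k : ZMod L × ZMod M, (k.1 = 0 ∨ k.1 = ((L / 2 : ℕ) : ZMod L)) →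
      (k.2 = 0 ∨ k.2 = ((M / 2 : ℕ) : ZMod M)) → -k = k :=
    fun k h0 h1 => (prod_neg_eq_self_iff hL hM k).2 ⟨h0, h1⟩
  ext k
  simp only [mem_filter, mem_univ, true_and]
  constructor
  · rintro ⟨hle, hk⟩
    rcases tubeBand_of_neg_eq_self hL hM hk with ⟨rfl, h⟩ | ⟨rfl, h⟩ | ⟨rfl, h⟩ | ⟨rfl, h⟩
    · split_ifs <;> simp
    · rw [h] at hle; rw [if_pos hle]; simp
    · rw [h] at hle; rw [if_pos hle]; simp
    · rw [h] at hle; linarith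
  · intro hk
    split_ifs at hk with h0
    · simp only [mem_insert, mem_singleton] at hk
      rcases hk with rfl | rfl | rfl
      · exact ⟨by rw [hb0]; linarith, hfix _ (Or.inl rfl) (Or.inl rfl)⟩
      · exact ⟨by rw [hba]; exact h0, hfix _ (Or.inl rfl) (Or.inr rfl)⟩
      · exact ⟨by rw [hbb]; exact h0, hfix _ (Or.inr rfl) (Or.inl rfl)⟩
    · simp only [mem_singleton] at hk
      subst hk
      exact ⟨by rw [hb0]; linarith, hfix _ (Or.inl rfl) (Or.inl rfl)⟩

/-- **Shell parity of the rectangular band.** For even `L, M` and a level `-4 ≤ μ < 4`, the number of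
momenta `k ∈ ℤ/L × ℤ/M` with `ε_{L,M}(k) ≤ μ` is ODD (the non-fixed points of `k ↦ -k` pair off, the fixed
ones below `μ` are `1` or `3`). Hence every closed shell of the free tube strictly below the top level
holds an odd number of momenta. [folklore] -/
theorem odd_card_filter_tubeBand_le (hL : Even L) (hM : Even M) {μ : ℝ} (hμ : μ < 4) (hμ' : -4 ≤ μ) :
    Odd (univ.filter fun k : ZMod L × ZMod M => tubeBand L M k ≤ μ).card := by
  set S := univ.filter fun k : ZMod L × ZMod M => tubeBand L M k ≤ μ with hS
  have hsplit := Finset.card_filter_add_card_filter_not (s := S) (fun k => -k = k)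
  have heven : Even (S.filter fun k => ¬ -k = k).card := by
    have h_mem : ∀ a ∈ S.filter (fun k => ¬ -k = k), -a ∈ S.filter (fun k => ¬ -k = k) := by
      intro a ha
      rw [mem_filter] at ha ⊢
      rw [hS, mem_filter] at ha ⊢
      refine ⟨⟨mem_univ _, by rw [tubeBand_neg]; exact ha.1.2⟩, ?_⟩
      rw [neg_neg]; exact fun h => ha.2 h.symm
    have h := Finset.sum_involution (s := S.filter fun k => ¬ -k = k) (f := fun _ ↦ (1 : ZMod 2))
      (fun a _ ↦ -a) (fun a _ ↦ by decide) (fun a ha _ ↦ (mem_filter.1 ha).2) (fun a ha ↦ h_mem a ha)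
      (fun a _ ↦ neg_neg a)
    rw [Finset.sum_const, nsmul_eq_mul, mul_one] at h
    exact ZMod.natCast_eq_zero_iff_even.mp h
  have hodd : Odd (S.filter fun k => -k = k).card := by
    have heq : (S.filter fun k => -k = k) =
        univ.filter fun k : ZMod L × ZMod M => tubeBand L M k ≤ μ ∧ -k = k := by
      rw [hS, Finset.filter_filter]
    rw [heq, filter_tubeBand_le_and_fixed_eq hL hM hμ hμ']
    have hM0 := half_ne_zero hM
    have hL0 := half_ne_zero hL
    have ha0 : ((0, ((M / 2 : ℕ) : ZMod M)) : ZMod L × ZMod M) ≠ (0, 0) := fun h => hM0 (congrArg Prod.snd h)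
    have hb0 : ((((L / 2 : ℕ) : ZMod L), 0) : ZMod L × ZMod M) ≠ (0, 0) := fun h => hL0 (congrArg Prod.fst h)
    have hab : ((0, ((M / 2 : ℕ) : ZMod M)) : ZMod L × ZMod M) ≠ (((L / 2 : ℕ) : ZMod L), 0) := fun h =>
      hL0 (congrArg Prod.fst h).symm
    split_ifs
    · rw [card_insert_of_notMem, card_insert_of_notMem, card_singleton]
      · decide
      · simpa using hab
      · simp only [mem_insert, mem_singleton, not_or]; exact ⟨ha0.symm, hb0.symm⟩
    · simp
  rw [← hsplit]
  exact Odd.add_even hodd heven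

end Shells


section Assembly

variable {L M : ℕ} [NeZero L] [NeZero M] {Λ : Type} [LinearOrder Λ] [Fintype Λ]
  (e : Λ ≃ ZMod L × ZMod M)

/-- **On an open shell the free pair compressibility vanishes.** For `L, M ≥ 3`, if the pair number
`n = N_{L,M}(δ)/2` sits strictly inside a shell of the free band (`#{ε < μ} < n < #{ε ≤ μ}`), then at
`U = 0` the crux functional `ẽ″_{L,M}(0, δ) = LM[E(N+2) + E(N−2) − 2E(N)]/4` is `0`: the three nested Fermi
seas `F₋ ⊂ F ⊂ F₊` at level `μ` (`exists_three_fermiSets`) give `E(N±2) − E(N) = ±2μ`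
(`tubeEnergy_free_eq`). Scalapino–White–Zhang (1993) §II (free-electron compressibility). [folklore] -/
theorem tubePairCompressibility_zero_coupling_eq_zero_of_openShell (hL : 3 ≤ L) (hM : 3 ≤ M) {δ : ℝ}
    {n : ℕ} (hN : tubeFilling L M δ = 2 * n) {μ : ℝ}
    (hlt : (univ.filter fun k : ZMod L × ZMod M => tubeBand L M k < μ).card < n)
    (hgt : n < (univ.filter fun k : ZMod L × ZMod M => tubeBand L M k ≤ μ).card) :
    tubePairCompressibility L M Λ e 0 δ = 0 := by
  obtain ⟨Fm, F, Fp, hcm, hc, hcp, ⟨hFm, hFm'⟩, ⟨hF, hF'⟩, ⟨hFp, hFp'⟩, hsm, hsp⟩ :=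
    exists_three_fermiSets (tubeBand L M) μ n hlt hgt
  have hn1 : 1 ≤ n := by omega
  have hNp : tubeFilling L M δ + 2 = 2 * Fp.card := by rw [hN, hcp]; ring
  have hNm : tubeFilling L M δ - 2 = 2 * Fm.card := by rw [hN, hcm]; omega
  have hN' : tubeFilling L M δ = 2 * F.card := by rw [hN, hc]
  rw [tubePairCompressibility, hNp, hNm, hN', tubeEnergy_free_eq e hL hM Fp μ hFp hFp',
    tubeEnergy_free_eq e hL hM Fm μ hFm hFm', tubeEnergy_free_eq e hL hM F μ hF hF', hsp, hsm]
  ring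

/-- For even `L, M`, an EVEN `n` with `0 < n < LM` is never a cumulative shell count `#{ε_{L,M} ≤ μ}`
(odd below the top level, `0` below the band, `LM` above it). [folklore] -/
theorem card_filter_tubeBand_le_ne (hLe : Even L) (hMe : Even M) {n : ℕ} (hn : Even n) (hn0 : 0 < n)
    (hnLM : n < L * M) (μ : ℝ) :
    (univ.filter fun k : ZMod L × ZMod M => tubeBand L M k ≤ μ).card ≠ n := by
  intro heq
  by_cases h4 : μ < 4
  · by_cases h4' : -4 ≤ μ
    · have hodd := odd_card_filter_tubeBand_le hLe hMe h4 h4'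
      rw [heq] at hodd
      exact (Nat.not_even_iff_odd.2 hodd) hn
    · have h0 : (univ.filter fun k : ZMod L × ZMod M => tubeBand L M k ≤ μ) = ∅ := by
        refine Finset.filter_false_of_mem fun k _ => ?_
        have := neg_four_le_tubeBand (L := L) (M := M) k
        linarith
      rw [h0, Finset.card_empty] at heq
      omega
  · have hall : (univ.filter fun k : ZMod L × ZMod M => tubeBand L M k ≤ μ) = univ :=
      Finset.filter_true_of_mem fun k _ => (tubeBand_le_four k).trans (not_lt.1 h4)
    rw [hall, Finset.card_univ, Fintype.card_prod, ZMod.card, ZMod.card] at heq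
    omega

/-- **Even pair numbers are open shells**: for even `L, M` (`≥ 3`, hence `≥ 4`), if
`N_{L,M}(δ) = 2n` with `n` even and `0 < n < LM`, then `ẽ″_{L,M}(0, δ) = 0`. [folklore] -/
theorem tubePairCompressibility_zero_coupling_eq_zero_of_even (hLe : Even L) (hMe : Even M) (hL : 3 ≤ L)
    (hM : 3 ≤ M) {δ : ℝ} {n : ℕ} (hN : tubeFilling L M δ = 2 * n) (hn : Even n) (hn0 : 0 < n)
    (hnLM : n < L * M) : tubePairCompressibility L M Λ e 0 δ = 0 := by
  obtain ⟨μ, hlt, hgt⟩ := exists_openShell_of_card_ne (tubeBand L M) hn0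
    (by rw [Fintype.card_prod, ZMod.card, ZMod.card]; exact hnLM.le) (card_filter_tubeBand_le_ne hLe hMe hn hn0 hnLM)
  exact tubePairCompressibility_zero_coupling_eq_zero_of_openShell e hL hM hN hlt hgt

end Assembly

/-! ### `0 < U` is load-bearing in `PerWidthThermodynamics` -/

section Headline

/-- The filling of the `2l × 4` tube: `N_{2l,4}(δ) = 2⌊4(1-δ) l⌋`. [folklore] -/
theorem tubeFilling_two_mul_four (δ : ℝ) (l : ℕ) : tubeFilling (2 * l) 4 δ = 2 * ⌊(4 * (1 - δ)) * l⌋₊ := by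
  rw [tubeFilling]
  congr 2
  push_cast
  ring

/-- **At width `4` the free pair compressibility vanishes beyond every length threshold.** For
`δ ∈ (0, 3/10)` and every `L₁` there is an even `L ≥ max(L₁, 4)` with `ẽ″_{L,4}(0, δ) = 0` for every
carrier (`⌊4(1-δ) l⌋` is even for infinitely many `l`, `exists_ge_even_floor`). [folklore] -/
theorem exists_admissible_tubePairCompressibility_zero_coupling_eq_zero {δ : ℝ} (hδ0 : 0 < δ) (hδ1 : δ < 3 / 10)
    (L₁ : ℕ) : ∃ L : ℕ, ∃ _ : NeZero L, Even L ∧ 4 ≤ L ∧ L₁ ≤ L ∧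
      ∀ (Λ : Type) [LinearOrder Λ] [Fintype Λ] (e : Λ ≃ ZMod L × ZMod 4),
        tubePairCompressibility L 4 Λ e 0 δ = 0 := by
  have hβ : 0 ≤ 4 * (1 - δ) := by linarith
  obtain ⟨l, hl, heven⟩ := exists_ge_even_floor hβ (max L₁ 4)
  have hl4 : 4 ≤ l := (le_max_right _ _).trans hl
  have hl1 : L₁ ≤ l := (le_max_left _ _).trans hl
  refine ⟨2 * l, ⟨by omega⟩, even_two_mul l, by omega, by omega, fun Λ _ _ e => ?_⟩
  haveI : NeZero (2 * l) := ⟨by omega⟩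
  have hfl := Nat.floor_le (a := 4 * (1 - δ) * l) (by positivity)
  have hfl' := Nat.lt_floor_add_one (4 * (1 - δ) * (l : ℝ))
  refine tubePairCompressibility_zero_coupling_eq_zero_of_even e (even_two_mul l) (by decide) (by omega)
    (by norm_num) (tubeFilling_two_mul_four δ l) heven ?_ ?_
  · -- `0 < n`: `4(1-δ) l ≥ 2.8 · 4 > 1`
    have : (1 : ℝ) < 4 * (1 - δ) * l := by
      have hl' : (4 : ℝ) ≤ l := by exact_mod_cast hl4
      nlinarith
    have h1 : (1 : ℝ) < (⌊4 * (1 - δ) * (l : ℝ)⌋₊ : ℕ) + 1 := by linarith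
    have h2 : 1 ≤ ⌊4 * (1 - δ) * (l : ℝ)⌋₊ := Nat.one_le_iff_ne_zero.2 fun h => by
      rw [h] at hfl'; push_cast at hfl'; linarith
    omega
  · -- `n < L · 4`
    have : (⌊4 * (1 - δ) * (l : ℝ)⌋₊ : ℝ) < ((2 * l * 4 : ℕ) : ℝ) := by
      push_cast
      have hl' : (4 : ℝ) ≤ l := by exact_mod_cast hl4
      nlinarith
    exact_mod_cast this

/-- **`0 < U` is load-bearing in `PerWidthThermodynamics` (stmt-HubbardSuperconductivity-18510).** The
crux with its leading `∃ U, 0 < U ∧ …` replaced by `U := 0` is FALSE: at every `δ ∈ (0, 3/10)` the width-`4`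
member violates the compressibility floor `0 < ẽ″_{L,4}` for infinitely many admissible even `L` (open
free shells, `exists_admissible_tubePairCompressibility_zero_coupling_eq_zero`), whatever `d, k, L₁`.
Reading: the per-width compressibility floor is an INTERACTION effect on the open-shell lengths; any
proof of the crux at `(U, δ)` must split the free shell degeneracy of the `L × M` tube for all but
finitely many `L`, at every width. The crux itself (`0 < U`) is untouched. [folklore] -/
theorem perWidthThermodynamics_false_at_zero_coupling :
    ¬ ∃ δ ∈ Set.Ioo (0 : ℝ) (3 / 10), ∀ (M : ℕ) [NeZero M], Even M → 2 ≤ M →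
        ∃ d : ℝ, 0 < d ∧ ∃ k : ℝ, ∃ L₁ : ℕ, ∀ (L : ℕ) [NeZero L], Even L → M ≤ L → L₁ ≤ L →
          ∀ (Λ : Type) [LinearOrder Λ] [Fintype Λ] (e : Λ ≃ ZMod L × ZMod M),
            d ≤ tubeStiffness L M Λ e 0 δ ∧ 0 < tubePairCompressibility L M Λ e 0 δ ∧
              tubePairCompressibility L M Λ e 0 δ ≤ k := by
  rintro ⟨δ, ⟨hδ0, hδ1⟩, h⟩
  obtain ⟨d, -, k, L₁, h1⟩ := h 4 (by decide) (by norm_num)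
  obtain ⟨L, hL, hLe, hL4, hL1, hzero⟩ := exists_admissible_tubePairCompressibility_zero_coupling_eq_zero hδ0 hδ1 L₁
  obtain ⟨-, hpos, -⟩ := h1 L hLe hL4 hL1 (Fin (L * 4))
    (finProdFinEquiv.symm.trans (Equiv.prodCongr (ZMod.finEquiv L).toEquiv (ZMod.finEquiv 4).toEquiv))
  rw [hzero] at hpos
  exact lt_irrefl _ hpos

end Headline

end Summit.HubbardSuperconductivity.HubbardSuperconductivity.Theorems.PerWidthThermodynamics.Negative

end
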